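import Summits.AnomalousDissipation.AnomalousDissipation.Theorems.NeutralTaylorWavesTaylorWaveQuasiSteadyHierarchy

/-!
# The eikonal / polarisation order of the ε-free hierarchy (line `windfibred`, rev 3)
# (crux stmt-AnomalousDissipation-16293, `NeutralTaylorWaves.TaylorWaveQuasiSteady`)

First structural consequences of the open core `stub_hierarchyW`, for its provers AND its refuters: the order
`s = 0` of the formal system (`hierarchyCoeff … 0 = 0`, `divCoeff … 0 = 0`), i.e. the coefficient of `ε⁻¹` of the
two-scale steady residual and divergence on the polynomial ansatz, reads pointwise on `T⁴`

  `((P_0 · k) − c_0 k_2) ∂_θ P_0 + (∂_θ Q_0) k = 0`,   `k · ∂_θ P_0 = 0`,   `k = ∇G + j`,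

(`hierarchyCoeff_zero`, `divCoeff_zero`: at `s = 0` only the index pair `a = b = 0` of the fast convection, the fast
pressure gradient of `Q_0` and the fast drift term survive).  Pairing the first identity with `k` and using the second
kills the `P_0`-term, so `|k|² ∂_θ Q_0 = 0`; and `k` vanishes nowhere as soon as `j i₀ ≠ 0` and `G` is invariant along
the axis `i₀` (`k_{i₀} = j_{i₀}`).  Hence (`eikonal_of_hierarchyCoeff_zero`):

* the leading pressure profile has NO fast dependence, `∂_θ Q_0 ≡ 0`;
* `((P_0 · k) − c_0 k_2) ∂_θ P_0 ≡ 0`: wherever the leading profile oscillates, the drifted leading field is tangent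
  to the phase fronts, `(P_0 − c_0 e_2) · ∇S = 0` — the FIRST-INTEGRAL CONDITION of the line cards (the phase is constant
  along the streamlines of the co-moving leading flow), now a theorem about the registered ε-free core rather than a
  design remark.  (With `k · ∂_θ P_0 = 0` the oscillating part of `P_0` is transversal, so `P_0 · k` is its θ-mean's
  component: the condition constrains the MEAN flow and the phase only.)

Registered as the tools sub-stub `stub_hierarchyWEikonal` of stmt-AnomalousDissipation-16293 (last theorem, conjunction
of the three displayed facts).  Pure algebra over the definitions of `Theorems/…Hierarchy.lean`; [folklore] (eikonal and
polarisation conditions of monophase nonlinear geometric optics: Cheverry–Guès–Métivier, Ann. Sci. ENS 36 (2003) §2).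
-/

-- `Summit.<Summit>.<Problem>` is the tree's mandated summit-side namespace (CONVENTIONS §2); for this
-- single-conjunct summit the two coincide, so the duplicate is deliberate.
set_option linter.dupNamespace false

noncomputable section

open scoped BigOperators InnerProductSpace
open Literature.Analysis.FunctionSpaces Literature.Analysis.FunctionSpaces.Torus

namespace Summit.AnomalousDissipation.AnomalousDissipation.Theorems.TaylorWaveQuasiSteady.Eikonal

open Summit.AnomalousDissipation.AnomalousDissipation.Theorems.TaylorWaveQuasiSteady

variable (j : Fin 3 → ℤ) (G : UnitAddTorus (Fin 3) → ℝ) (f : UnitAddTorus (Fin 3) → EuclideanSpace ℝ (Fin 3)) (N : ℕ)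
  (P : ℕ → UnitAddTorus (Fin 4) → EuclideanSpace ℝ (Fin 3)) (Q : ℕ → UnitAddTorus (Fin 4) → ℝ) (c : ℕ → ℝ)

/-! ## §1 The order `s = 0` of the formal system, unfolded -/

/-- **The formal divergence at order `0`** is the fast divergence of the leading profile:
`divCoeff … 0 y = ∑ᵢ kᵢ (∂_θ P_0)ᵢ`. [folklore] -/
theorem divCoeff_zero (y : UnitAddTorus (Fin 4)) :
    divCoeff j G N P 0 y = ∑ i : Fin 3, (fDeriv j G i (P 0) y) i := by
  unfold divCoeff
  have h1 : ∀ a ∈ Finset.range (N + 1),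
      ((if a + 1 = 0 then ∑ i : Fin 3, (sDeriv i (P a) y) i else 0) +
        (if a = 0 then ∑ i : Fin 3, (fDeriv j G i (P a) y) i else 0)) =
      (if a = 0 then ∑ i : Fin 3, (fDeriv j G i (P a) y) i else 0) := fun a _ => by
    rw [if_neg (Nat.succ_ne_zero a), zero_add]
  rw [Finset.sum_congr rfl h1, Finset.sum_ite_eq']
  simp

/-- **The formal residual at order `0`** (coefficient of `ε⁻¹`): fast self-convection of the leading profile, fast
pressure gradient of `Q_0`, fast drift term:
`hierarchyCoeff … 0 y = ∑ₗ (P_0)ₗ kₗ∂_θP_0 + (kᵢ ∂_θ Q_0)ᵢ − c_0 k_2 ∂_θ P_0`. [folklore] -/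
theorem hierarchyCoeff_zero (y : UnitAddTorus (Fin 4)) :
    hierarchyCoeff j G f N P Q c 0 y =
      (∑ l : Fin 3, (P 0 y) l • fDeriv j G l (P 0) y)
        + WithLp.toLp 2 (fun i : Fin 3 => fDeriv j G i (Q 0) y)
        - c 0 • fDeriv j G 2 (P 0) y := by
  have h0 : (0 : ℕ) ∈ Finset.range (N + 1) := Finset.mem_range.2 (Nat.succ_pos N)
  -- convection: only `a = b = 0` survives
  have hconv : (∑ a ∈ Finset.range (N + 1), ∑ b ∈ Finset.range (N + 1),
      ((if a + b + 1 = 0 then ∑ l : Fin 3, (P a y) l • sDeriv l (P b) y else 0) +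
        (if a + b = 0 then ∑ l : Fin 3, (P a y) l • fDeriv j G l (P b) y else 0))) =
      ∑ l : Fin 3, (P 0 y) l • fDeriv j G l (P 0) y := by
    rw [Finset.sum_eq_single_of_mem 0 h0]
    · rw [Finset.sum_eq_single_of_mem 0 h0]
      · simp
      · intro b _ hb
        rw [if_neg (Nat.succ_ne_zero _), if_neg (by omega), add_zero]
    · intro a _ ha
      refine Finset.sum_eq_zero fun b _ => ?_
      rw [if_neg (Nat.succ_ne_zero _), if_neg (by omega), add_zero]
  -- viscosity: nothing survives
  have hvisc : (∑ a ∈ Finset.range (N + 1),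
      ((if a + 3 = 0 then ∑ i : Fin 3, sDeriv i (sDeriv i (P a)) y else 0) +
        (if a + 2 = 0 then ∑ i : Fin 3, (sDeriv i (fDeriv j G i (P a)) y + fDeriv j G i (sDeriv i (P a)) y)
          else 0) +
        (if a + 1 = 0 then ∑ i : Fin 3, fDeriv j G i (fDeriv j G i (P a)) y else 0))) = 0 := by
    refine Finset.sum_eq_zero fun a _ => ?_
    rw [if_neg (by omega), if_neg (by omega), if_neg (Nat.succ_ne_zero _), add_zero, add_zero]
  -- pressure: only `a = 0`, fast part
  have hpres : (∑ a ∈ Finset.range (N + 1),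
      WithLp.toLp 2 (fun i : Fin 3 =>
        (if a + 1 = 0 then sDeriv i (Q a) y else 0) + (if a = 0 then fDeriv j G i (Q a) y else 0))) =
      WithLp.toLp 2 (fun i : Fin 3 => fDeriv j G i (Q 0) y) := by
    rw [Finset.sum_eq_single_of_mem 0 h0]
    · congr 1
      funext i
      rw [if_neg (Nat.succ_ne_zero 0), if_pos rfl, zero_add]
    · intro a _ ha
      have : (fun i : Fin 3 =>
          (if a + 1 = 0 then sDeriv i (Q a) y else 0) + (if a = 0 then fDeriv j G i (Q a) y else 0)) = 0 := by
        funext i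
        rw [if_neg (Nat.succ_ne_zero a), if_neg ha, add_zero]
        rfl
      rw [this]
      rfl
  -- drift: only `a = b = 0`, fast part
  have hdrift : (∑ a ∈ Finset.range (N + 1), ∑ b ∈ Finset.range (N + 1),
      ((if a + b + 1 = 0 then c a • sDeriv 2 (P b) y else 0) +
        (if a + b = 0 then c a • fDeriv j G 2 (P b) y else 0))) = c 0 • fDeriv j G 2 (P 0) y := by
    rw [Finset.sum_eq_single_of_mem 0 h0]
    · rw [Finset.sum_eq_single_of_mem 0 h0]
      · simp
      · intro b _ hb
        rw [if_neg (Nat.succ_ne_zero _), if_neg (by omega), add_zero]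
    · intro a _ ha
      refine Finset.sum_eq_zero fun b _ => ?_
      rw [if_neg (Nat.succ_ne_zero _), if_neg (by omega), add_zero]
  unfold hierarchyCoeff
  rw [hconv, hvisc, hpres, hdrift, if_neg (zero_ne_one : (0 : ℕ) ≠ 1), sub_zero, sub_zero]

/-! ## §2 The phase gradient vanishes nowhere -/

/-- If `j i₀ ≠ 0` and `G` is invariant along the axis `i₀` then `k_{i₀} = j_{i₀} ≠ 0`, so `|k|² = ∑ᵢ kᵢ² > 0` at every
slow point. [folklore] -/
theorem sum_sq_phaseGrad_pos {j : Fin 3 → ℤ} {G : UnitAddTorus (Fin 3) → ℝ} {i₀ : Fin 3} (hj : j i₀ ≠ 0)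
    (hG : ∀ x, Torus.partialDeriv i₀ G x = 0) (x : UnitAddTorus (Fin 3)) :
    0 < ∑ i : Fin 3, phaseGrad j G i x ^ 2 := by
  have hk : phaseGrad j G i₀ x ≠ 0 := by
    rw [phaseGrad, hG, zero_add]
    exact_mod_cast hj
  have h1 : phaseGrad j G i₀ x ^ 2 ≤ ∑ i : Fin 3, phaseGrad j G i x ^ 2 :=
    Finset.single_le_sum (f := fun i => phaseGrad j G i x ^ 2) (fun i _ => sq_nonneg _) (Finset.mem_univ i₀)
  exact lt_of_lt_of_le (by positivity) h1

/-! ## §3 The eikonal / polarisation consequences -/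

/-- **Order zero of the hierarchy, solved.**  If `hierarchyCoeff … 0 ≡ 0` and `divCoeff … 0 ≡ 0` (the order `s = 0` of
the registered ε-free core `stub_hierarchyW`), `j i₀ ≠ 0` and `∂_{i₀} G ≡ 0`, then at every point of `T⁴`:
`∂_θ Q_0 = 0` (the leading pressure has no fast dependence) and `((P_0·k) − c_0 k_2) ∂_θ P_0 = 0` (first-integral
condition: where the leading profile oscillates, the drifted leading field is tangent to the phase fronts). [folklore] -/
theorem eikonal_of_order_zero {j : Fin 3 → ℤ} {i₀ : Fin 3} {G : UnitAddTorus (Fin 3) → ℝ}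
    {f : UnitAddTorus (Fin 3) → EuclideanSpace ℝ (Fin 3)} {N : ℕ}
    {P : ℕ → UnitAddTorus (Fin 4) → EuclideanSpace ℝ (Fin 3)} {Q : ℕ → UnitAddTorus (Fin 4) → ℝ} {c : ℕ → ℝ}
    (hj : j i₀ ≠ 0) (hG : ∀ x, Torus.partialDeriv i₀ G x = 0)
    (h0 : ∀ y, hierarchyCoeff j G f N P Q c 0 y = 0) (hd0 : ∀ y, divCoeff j G N P 0 y = 0)
    (y : UnitAddTorus (Fin 4)) :
    Torus.partialDeriv (Fin.last 3) (Q 0) y = 0 ∧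
      ((∑ l : Fin 3, (P 0 y) l * phaseGrad j G l (slow y)) - c 0 * phaseGrad j G 2 (slow y)) •
        Torus.partialDeriv (Fin.last 3) (P 0) y = 0 := by
  -- abbreviations: `k i`, `D = ∂_θ P_0 (y)`, `q = ∂_θ Q_0 (y)`, `α = P_0·k − c_0 k_2`
  set D : EuclideanSpace ℝ (Fin 3) := Torus.partialDeriv (Fin.last 3) (P 0) y with hD
  set q : ℝ := Torus.partialDeriv (Fin.last 3) (Q 0) y with hq
  set k : Fin 3 → ℝ := fun i => phaseGrad j G i (slow y) with hk
  set α : ℝ := (∑ l : Fin 3, (P 0 y) l * k l) - c 0 * k 2 with hα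
  -- the order-0 identities, componentwise
  have hM := h0 y
  rw [hierarchyCoeff_zero] at hM
  have hcomp : ∀ i : Fin 3, α * D i + k i * q = 0 := by
    intro i
    have h := congrArg (fun v : EuclideanSpace ℝ (Fin 3) => v i) hM
    simp only [fDeriv, PiLp.sub_apply, PiLp.add_apply, PiLp.smul_apply, WithLp.ofLp_sum, Finset.sum_apply,
      smul_eq_mul, PiLp.zero_apply] at h
    have : α * D i + k i * q =
        (∑ l : Fin 3, (P 0 y) l * (phaseGrad j G l (slow y) * D i)) + phaseGrad j G i (slow y) * q
          - c 0 * (phaseGrad j G 2 (slow y) * D i) := by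
      rw [hα, hk, sub_mul, Finset.sum_mul]
      simp only [mul_assoc]
      ring
    rw [this]
    exact h
  have hdiv : ∑ i : Fin 3, k i * D i = 0 := by
    have h := hd0 y
    rw [divCoeff_zero] at h
    simpa only [fDeriv, PiLp.smul_apply, smul_eq_mul] using h
  -- pair with `k`: `α (k·D) + q |k|² = 0`, hence `q |k|² = 0`
  have hpair : q * ∑ i : Fin 3, k i ^ 2 = 0 := by
    have h1 : ∑ i : Fin 3, k i * (α * D i + k i * q) = 0 :=
      Finset.sum_eq_zero fun i _ => by rw [hcomp i, mul_zero]
    have h2 : ∑ i : Fin 3, k i * (α * D i + k i * q) = α * ∑ i : Fin 3, k i * D i + q * ∑ i : Fin 3, k i ^ 2 := by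
      rw [Finset.mul_sum, Finset.mul_sum, ← Finset.sum_add_distrib]
      exact Finset.sum_congr rfl fun i _ => by ring
    rw [h2, hdiv, mul_zero, zero_add] at h1
    exact h1
  have hk2 : 0 < ∑ i : Fin 3, k i ^ 2 := sum_sq_phaseGrad_pos hj hG (slow y)
  have hq0 : q = 0 := by
    rcases mul_eq_zero.1 hpair with h | h
    · exact h
    · exact absurd h hk2.ne'
  refine ⟨hq0, ?_⟩
  -- back to the components: `α D i = 0`
  ext i
  have h := hcomp i
  rw [hq0, mul_zero, add_zero] at h
  simpa only [PiLp.smul_apply, smul_eq_mul, PiLp.zero_apply] using h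

/-! ## §4 The registered tools sub-stub -/

/-- **stub_hierarchyWEikonal** (registered tools sub-stub of stmt-AnomalousDissipation-16293; conjunction of the
facts of this file): the unfolded order `0` of `divCoeff` and `hierarchyCoeff`, `|k|² > 0`, and the eikonal /
polarisation consequences `∂_θ Q_0 = 0`, `((P_0·k) − c_0 k_2) ∂_θ P_0 = 0`. [folklore] -/
theorem stub_hierarchyWEikonal : (∀ (j : Fin 3 → ℤ) (G : UnitAddTorus (Fin 3) → ℝ) (N : ℕ) (P : ℕ → UnitAddTorus (Fin 4) → EuclideanSpace ℝ (Fin 3)) (y : UnitAddTorus (Fin 4)), divCoeff j G N P 0 y = ∑ i : Fin 3, (fDeriv j G i (P 0) y) i) ∧ (∀ (j : Fin 3 → ℤ) (G : UnitAddTorus (Fin 3) → ℝ) (f : UnitAddTorus (Fin 3) → EuclideanSpace ℝ (Fin 3)) (N : ℕ) (P : ℕ → UnitAddTorus (Fin 4) → EuclideanSpace ℝ (Fin 3)) (Q : ℕ → UnitAddTorus (Fin 4) → ℝ) (c : ℕ → ℝ) (y : UnitAddTorus (Fin 4)), hierarchyCoeff j G f N P Q c 0 y = (∑ l : Fin 3,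 (P 0 y) l • fDeriv j G l (P 0) y) + WithLp.toLp 2 (fun i : Fin 3 => fDeriv j G i (Q 0) y) - c 0 • fDeriv j G 2 (P 0) y) ∧ (∀ (j : Fin 3 → ℤ) (G : UnitAddTorus (Fin 3) → ℝ) (i₀ : Fin 3), j i₀ ≠ 0 → (∀ x, Literature.Analysis.FunctionSpaces.Torus.partialDeriv i₀ G x = 0) → ∀ x : UnitAddTorus (Fin 3), 0 < ∑ i : Fin 3, phaseGrad j G i x ^ 2) ∧ (∀ (j : Fin 3 → ℤ) (i₀ : Fin 3) (G : UnitAddTorus (Fin 3) → ℝ) (f : UnitAddTorus (Fin 3) → EuclideanSpace ℝ (Fin 3)) (N : ℕ) (P : ℕ → UnitAddTorus (Fin 4) → EuclideanSpace ℝ (Fin 3)) (Q : ℕ → UnitAddTorus (Fin 4) → ℝ) (c : ℕ → ℝ), j i₀ ≠ 0 → (∀ x, Literature.Analysis.FunctionSpaces.Torus.partialDeriv i₀ G x = 0) → (∀ y, hierarchyCoeff j G f N P Q c 0 y = 0) → (∀ y, divCoeff j G N P 0 y = 0) → ∀ y : UnitAddTorus (Fin 4), Literature.Analysis.FunctionSpaces.Torus.partialDeriv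 (Fin.last 3) (Q 0) y = 0 ∧ ((∑ l : Fin 3, (P 0 y) l * phaseGrad j G l (slow y)) - c 0 * phaseGrad j G 2 (slow y)) • Literature.Analysis.FunctionSpaces.Torus.partialDeriv (Fin.last 3) (P 0) y = 0) :=
  ⟨divCoeff_zero, hierarchyCoeff_zero, fun _ _ _ hj hG => sum_sq_phaseGrad_pos hj hG,
    fun _ _ _ _ _ _ _ _ hj hG h0 hd0 => eikonal_of_order_zero hj hG h0 hd0⟩

end Summit.AnomalousDissipation.AnomalousDissipation.Theorems.TaylorWaveQuasiSteady.Eikonal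

end
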